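import Literature.MathematicalPhysics.QuantumFieldTheory.Balaban1983to89.B7Prop4GeneralLevels
import Literature.MathematicalPhysics.QuantumFieldTheory.Balaban1983to89.B7Eq92Concrete
import Summits.QuantumFields.BalabanUV.T4Continuum.Spine.NE1p.B7AveragingPureGaugeCommutator

/-!
# T⁴ programme, spine estimate NE1′ (node O3b/H2) — GAUGE COVARIANCE OF THE PRINTED COMPOSITE `Q_j` (127):
# `Q_j(U₀^{u}, A^{u})(c) = u(Lʲc₋)·Q_j(U₀, A)(c)·u(Lʲc₋)⁻¹` for EVERY invertible gauge function `u` (no smallness, no unitarity),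
# `A^{u}(b) = u(b₋)A(b)u(b₋)⁻¹` the transported field — hence its quadratic term in a slot is conjugated, its norm unchanged for unitary `u`

Cell `pub-balaban-gaps` (YM blitz Y1, track G2), seat `ne1` gen 11 session 3 (prover-pub-balaban-gaps-ne1-g11-0); record `HOME/ne/NE1.md`
§4 R67.  ADDITIVE — imports the lineage's `B7Prop4GeneralLevels` (`logCovIter` = the printed `Q_j(U₀, ηA)`, (127); `Qcov` (121) through
`B7Prop3GeneralLinear`), `B7Eq92Concrete` (the one-step objects at a general background: the twisted transport `tHol` (58), the frame
exponent `Fcov` (62)∕(82), the frame `wframe`, `tild` (65), the double-bar average `dbavgCov` (89); `Rc`, `expUnit_conj`), through them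
`B7Prop6Flat` (HYPOTHESIS-FREE covariance of the averages for arbitrary invertible gauge functions: `bavg_gaugeAct_units` (45),
`avgIter_gaugeAct_units` (11)∕(43), `mlog_conj` (57)), `B7AvgGaugeCovariance.uLev` (`u_j(z) = u(Lʲz)`), `B7Prop1Explicit.hol_gaugeAct` (8),
and this seat's gen-10 file 13 `B7AveragingPureGaugeCommutator` (`iteratedDeriv_two_units_conj`) BY NAME; nothing edited or restated; 0 def
(the transported field is carried as a hypothesis `hAA′ : A′(b) = u(b₋)A(b)u(b₋)⁻¹`, as in file 17).

PRINT.  [Balaban1985Averaging] (8) p. 18 `U^u(x,x′) = u(x)U(x,x′)u(x′)⁻¹`; (11) p. 19 «\overline{U^u} = (Ū)^u»; (45) p. 24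
«(\overline{U^u})_c = u(c₋)Ū_c u⁻¹(c₊)»; (57) p. 27 «R(X)f(Y) = f(R(X)Y)»; (58)–(59) p. 27 (covariance of the twisted transport and of
`Ṽ₁` under moving frames); (89) p. 31; (121) p. 36 `Q(V₀, A, c) = (1∕i) log(V̿₁)_c`; (127) p. 37.  Print uses the covariance of every
one-step object under gauge transformations of the FINE lattice throughout §2–§3 without displaying the composite statement; THIS file
displays and proves it for the lineage's concrete objects, for arbitrary invertible `u` (the formal identities need no smallness).

WHAT THIS FILE PROVES ([folklore] algebra on the lineage's definitions; 0 sorry):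
* §1 one step at a general background `V₀`, for units-valued `V₁′(b) = u(b₋)V₁(b)u(b₋)⁻¹`: `conjCfg_mul_gaugeAct` (`V₁′·V₀^{u} = (V₁V₀)^{u}`),
  `tHol_gaugeAct` (`(R_{0,y}V₁′)[V₀^{u}](Γ) = u(y)·(R_{0,y}V₁)[V₀](Γ)·u(y)⁻¹`), `Fcov_gaugeAct`, `wframe_gaugeAct`, `tild_gaugeAct`,
  `dbavgCov_gaugeAct` (`V̿₁′[V₀^{u}](c) = u(c₋)·V̿₁[V₀](c)·u(c₋)⁻¹`), `expCfg_conj` (`e^{A^{u}} = (e^{A})′`), **`Qcov_gaugeAct`**: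
  `Q(V₀^{u}, A^{u}, c) = u(c₋)·Q(V₀, A, c)·u(c₋)⁻¹`.
* §2 **`logCovIter_gaugeAct`** — for every `j`, every level-`j` bond `c = ⟨z, z + e_κ⟩`:
  `Q_j(U₀^{u}, A^{u})(c) = u(Lʲz)·Q_j(U₀, A)(c)·u(Lʲz)⁻¹` (induction with `avgIter_gaugeAct_units`); `logCovIter_gaugeAct_smul` (the same
  along the slot ray `τA`, `(τA)^{u} = τA^{u}`); **`iteratedDeriv_two_logCovIter_gaugeAct`** — the quadratic term in `τ` at `0` is conjugated
  likewise, whenever `τ ↦ Q_j(U₀, τA)(c)` is analytic at `0` (file 13's `iteratedDeriv_two_units_conj`);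
  **`norm_iteratedDeriv_two_logCovIter_gaugeAct_le`** — for `u` unit-ball valued (`‖u‖, ‖u⁻¹‖ ≤ 1`, `U1`) the norm of the quadratic term
  at `(U₀^{u}, A^{u})` is at most the one at `(U₀, A)`.
What it does NOT do: no estimate is proved here (files 19∕20 supply them); the axial gauge ∕ generator-free local form is the next file.

HONEST FRAMING.  [folklore] algebra over the lineage's verbatim ℤᵈ model of [B7]; nothing of Bałaban's asserted beyond print; NE1′ NOT
proved; spine 0∕9; (B) 0∕13; binders 0∕6; one finite T⁴ — NOT ℝ⁴, NOT infinite volume, NOT a mass gap, NOT Clay.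
-/

noncomputable section

open scoped Topology BigOperators
open NormedSpace Filter Finset

namespace Summit.QuantumFields.BalabanUV.T4Continuum.NE1p.B7AveragingCommutator

open Literature.MathematicalPhysics.QuantumFieldTheory.Balaban1983to89.B7Prop1Explicit
open Literature.MathematicalPhysics.QuantumFieldTheory.Balaban1983to89.B7Prop2Explicit (avgIter)
open Literature.MathematicalPhysics.QuantumFieldTheory.Balaban1983to89.B7Prop3Flat (expCfg)
open Literature.MathematicalPhysics.QuantumFieldTheory.Balaban1983to89.B7AvgGaugeCovariance (uLev uLev_apply uLev_zero uLev_smul)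
open Literature.MathematicalPhysics.QuantumFieldTheory.Balaban1983to89.B7Prop6Flat (bavg_gaugeAct_units avgIter_gaugeAct_units mlog_conj)
open Literature.MathematicalPhysics.QuantumFieldTheory.Balaban1983to89.B7Eq92Concrete (Rc Rc_apply tHol Fcov wframe tild dbavgCov
  tild_apply dbavgCov_apply expUnit_conj)
open Literature.MathematicalPhysics.QuantumFieldTheory.Balaban1983to89.B7Prop3GeneralLinear (Qcov)
open Literature.MathematicalPhysics.QuantumFieldTheory.Balaban1983to89.B7Prop4GeneralLevels (logCovIter logCovIter_zero logCovIter_succ)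
open Literature.MathematicalPhysics.QuantumFieldTheory.Balaban1983to89.MatrixLog (mlog)

variable {d : ℕ} {𝔸 : Type*} [NormedRing 𝔸] [NormedAlgebra ℂ 𝔸] [CompleteSpace 𝔸]

/-! ## §1 One step: the objects (58), (62)∕(82), (65), (89), (121) under a gauge transformation of the fine lattice -/

section OneStep

variable (L : ℕ) (u : Site d → 𝔸ˣ) (V₀ V₁ V₁' : Site d → Fin d → 𝔸ˣ)
  (hV : ∀ (x : Site d) (μ : Fin d), V₁' x μ = u x * V₁ x μ * (u x)⁻¹)

include hV in
omit [NormedAlgebra ℂ 𝔸] [CompleteSpace 𝔸] in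
/-- `V₁′·V₀^{u} = (V₁·V₀)^{u}` for `V₁′(b) = u(b₋)V₁(b)u(b₋)⁻¹` ((8): the left factor `u(b₋)` of `V₀^{u}(b)` conjugates `V₁(b)`).
[cite: Balaban1985Averaging, (8) p.18] -/
theorem conjCfg_mul_gaugeAct : V₁' * gaugeAct u V₀ = gaugeAct u (V₁ * V₀) := by
  funext x μ
  simp only [Pi.mul_apply, gaugeAct, hV x μ]
  group

include hV in
omit [NormedAlgebra ℂ 𝔸] [CompleteSpace 𝔸] in
/-- **Covariance of the twisted transport (58)**: `(R_{0,y}V₁′)[V₀^{u}](Γ) = u(y)·(R_{0,y}V₁)[V₀](Γ)·u(y)⁻¹` ((8) for `(V₁V₀)^{u}` and for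
`V₀^{u}`: the end-point factors cancel). [cite: Balaban1985Averaging, (58) p.27, (8) p.18] -/
theorem tHol_gaugeAct (y : Site d) (w : List (Letter d)) :
    tHol (gaugeAct u V₀) V₁' y w = u y * tHol V₀ V₁ y w * (u y)⁻¹ := by
  unfold tHol
  rw [conjCfg_mul_gaugeAct u V₀ V₁ V₁' hV, hol_gaugeAct, hol_gaugeAct]
  group

include hV in
omit [CompleteSpace 𝔸] in
/-- **Covariance of the frame exponent (62)∕(82)**: `F[V₀^{u}, V₁′](y) = u(y)·F[V₀, V₁](y)·u(y)⁻¹` (`log(uXu⁻¹) = u(log X)u⁻¹`, (57)).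
[cite: Balaban1985Averaging, (62) p.28, (82) p.30, (57) p.27] -/
theorem Fcov_gaugeAct (y : Site d) :
    Fcov L (gaugeAct u V₀) V₁' y = (u y : 𝔸) * Fcov L V₀ V₁ y * (((u y)⁻¹ : 𝔸ˣ) : 𝔸) := by
  unfold Fcov
  rw [Finset.mul_sum, Finset.sum_mul]
  refine Finset.sum_congr rfl fun r _ => ?_
  rw [tHol_gaugeAct u V₀ V₁ V₁' hV, Units.val_mul, Units.val_mul, mlog_conj, mul_smul_comm, smul_mul_assoc]

include hV in
/-- **Covariance of the block frame**: `\overline{R_{0,y}V₁′}[V₀^{u}] = u(y)·\overline{R_{0,y}V₁}[V₀]·u(y)⁻¹` (`exp(uFu⁻¹) = u e^{F} u⁻¹`).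
[cite: Balaban1985Averaging, (82) p.30, (57) p.27] -/
theorem wframe_gaugeAct (y : Site d) : wframe L (gaugeAct u V₀) V₁' y = u y * wframe L V₀ V₁ y * (u y)⁻¹ := by
  unfold wframe
  rw [Fcov_gaugeAct L u V₀ V₁ V₁' hV, expUnit_conj, Rc_apply]

include hV in
/-- **Covariance of (65)**: `Ṽ₁′[V₀^{u}](c) = u(c₋)·Ṽ₁[V₀](c)·u(c₋)⁻¹` ((45) for `(V₁V₀)^{u}` and for `V₀^{u}`, hypothesis-free form
`bavg_gaugeAct_units`). [cite: Balaban1985Averaging, (65) p.29, (45) p.24, (59) p.27] -/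
theorem tild_gaugeAct (q : Site d) (κ : Fin d) :
    tild L (gaugeAct u V₀) V₁' q κ = u q * tild L V₀ V₁ q κ * (u q)⁻¹ := by
  rw [tild_apply, tild_apply, conjCfg_mul_gaugeAct u V₀ V₁ V₁' hV, bavg_gaugeAct_units, bavg_gaugeAct_units]
  group

include hV in
/-- **Covariance of the double-bar average (89)**: `V̿₁′[V₀^{u}](c) = u(c₋)·V̿₁[V₀](c)·u(c₋)⁻¹`.
[cite: Balaban1985Averaging, (89) p.31, (59) p.27, (45) p.24] -/
theorem dbavgCov_gaugeAct (q : Site d) (κ : Fin d) :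
    dbavgCov L (gaugeAct u V₀) V₁' q κ = u q * dbavgCov L V₀ V₁ q κ * (u q)⁻¹ := by
  rw [dbavgCov_apply, dbavgCov_apply, wframe_gaugeAct L u V₀ V₁ V₁' hV, wframe_gaugeAct L u V₀ V₁ V₁' hV,
    tild_gaugeAct L u V₀ V₁ V₁' hV, bavg_gaugeAct_units, Rc_apply, Rc_apply]
  group

variable {A A' : Site d → Fin d → 𝔸} (hAA' : ∀ (x : Site d) (μ : Fin d), A' x μ = (u x : 𝔸) * A x μ * (((u x)⁻¹ : 𝔸ˣ) : 𝔸))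

include hAA' in
/-- `e^{A^{u}}(b) = u(b₋)·e^{A}(b)·u(b₋)⁻¹` (`exp(uXu⁻¹) = u e^{X} u⁻¹`). [cite: Balaban1985Averaging, (57) p.27, (109) p.34] -/
theorem expCfg_conj (x : Site d) (μ : Fin d) : expCfg A' x μ = u x * expCfg A x μ * (u x)⁻¹ := by
  unfold expCfg
  rw [hAA', expUnit_conj, Rc_apply]

include hAA' in
/-- **COVARIANCE OF THE ONE-STEP MAP (121)**: `Q(V₀^{u}, A^{u}, c) = u(c₋)·Q(V₀, A, c)·u(c₋)⁻¹` for every invertible gauge function `u`.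
[cite: Balaban1985Averaging, (121) p.36, (59) p.27, (57) p.27] -/
theorem Qcov_gaugeAct (q : Site d) (κ : Fin d) :
    Qcov L (gaugeAct u V₀) A' q κ = (u q : 𝔸) * Qcov L V₀ A q κ * (((u q)⁻¹ : 𝔸ˣ) : 𝔸) := by
  unfold Qcov
  rw [dbavgCov_gaugeAct L u V₀ (expCfg A) (expCfg A') (expCfg_conj u hAA'), Units.val_mul, Units.val_mul, mlog_conj]

end OneStep

/-! ## §2 The composite (127) -/

section Composite

variable (L : ℕ) (u : Site d → 𝔸ˣ) (U₀ : Site d → Fin d → 𝔸ˣ) {A A' : Site d → Fin d → 𝔸}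
  (hAA' : ∀ (x : Site d) (μ : Fin d), A' x μ = (u x : 𝔸) * A x μ * (((u x)⁻¹ : 𝔸ˣ) : 𝔸))

include hAA' in
/-- **GAUGE COVARIANCE OF THE PRINTED COMPOSITE `Q_j` (127)**: for every invertible gauge function `u` of the fine lattice, every `j` and
every bond `c = ⟨z, z + e_κ⟩` of the `j`-th lattice, `Q_j(U₀^{u}, A^{u})(c) = u(Lʲz)·Q_j(U₀, A)(c)·u(Lʲz)⁻¹` — induction on `j` with the
one-step covariance at the background `Ū₀ʲ` and (11) «\overline{U^u}ʲ = (Ūʲ)^{u_j}» (`avgIter_gaugeAct_units`).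
[cite: Balaban1985Averaging, (127) p.37, (11) p.19, (121) p.36] -/
theorem logCovIter_gaugeAct : ∀ (j : ℕ) (z : Site d) (κ : Fin d),
    logCovIter L (gaugeAct u U₀) A' j z κ = ((uLev L u j z : 𝔸ˣ) : 𝔸) * logCovIter L U₀ A j z κ * (((uLev L u j z)⁻¹ : 𝔸ˣ) : 𝔸)
  | 0, z, κ => by simp only [logCovIter_zero, uLev_zero]; exact hAA' z κ
  | j + 1, z, κ => by
    rw [logCovIter_succ, logCovIter_succ, avgIter_gaugeAct_units,
      Qcov_gaugeAct L (uLev L u j) (avgIter L U₀ j) (fun x μ => logCovIter_gaugeAct j x μ), uLev_smul]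

include hAA' in
/-- The same along the slot ray: `(τA)^{u} = τ·A^{u}`, so `Q_j(U₀^{u}, τA^{u})(c) = u(Lʲz)·Q_j(U₀, τA)(c)·u(Lʲz)⁻¹` for every `τ`.
[cite: Balaban1985Averaging, (127) p.37, (11) p.19] -/
theorem logCovIter_gaugeAct_smul (τ : ℂ) (j : ℕ) (z : Site d) (κ : Fin d) :
    logCovIter L (gaugeAct u U₀) (τ • A') j z κ
      = ((uLev L u j z : 𝔸ˣ) : 𝔸) * logCovIter L U₀ (τ • A) j z κ * (((uLev L u j z)⁻¹ : 𝔸ˣ) : 𝔸) :=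
  logCovIter_gaugeAct L u U₀ (A := τ • A) (A' := τ • A')
    (fun x μ => by simp only [Pi.smul_apply]; rw [hAA', mul_smul_comm, smul_mul_assoc]) j z κ

include hAA' in
/-- **The quadratic term is conjugated**: if `τ ↦ Q_j(U₀, τA)(c)` is analytic at `0` (e.g. Prop. 7), then
`∂_τ²|₀ Q_j(U₀^{u}, τA^{u})(c) = u(Lʲz)·∂_τ²|₀ Q_j(U₀, τA)(c)·u(Lʲz)⁻¹` (file 13's `iteratedDeriv_two_units_conj` on the derivative data of
the analytic germ). [cite: Balaban1985Averaging, (127) p.37, (11) p.19] -/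
theorem iteratedDeriv_two_logCovIter_gaugeAct (j : ℕ) (z : Site d) (κ : Fin d)
    (hQ : AnalyticAt ℂ (fun τ : ℂ => logCovIter L U₀ (τ • A) j z κ) 0) :
    iteratedDeriv 2 (fun τ : ℂ => logCovIter L (gaugeAct u U₀) (τ • A') j z κ) 0
      = ((uLev L u j z : 𝔸ˣ) : 𝔸) * iteratedDeriv 2 (fun τ : ℂ => logCovIter L U₀ (τ • A) j z κ) 0 * (((uLev L u j z)⁻¹ : 𝔸ˣ) : 𝔸) := by
  set f : ℂ → 𝔸 := fun τ : ℂ => logCovIter L U₀ (τ • A) j z κ with hf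
  have heq : (fun τ : ℂ => logCovIter L (gaugeAct u U₀) (τ • A') j z κ)
      = fun τ : ℂ => ((uLev L u j z : 𝔸ˣ) : 𝔸) * f τ * (((uLev L u j z)⁻¹ : 𝔸ˣ) : 𝔸) :=
    funext fun τ => logCovIter_gaugeAct_smul L u U₀ hAA' τ j z κ
  rw [heq]
  have hF : ∀ᶠ t in 𝓝 (0 : ℂ), HasDerivAt f (deriv f t) t := by
    filter_upwards [hQ.eventually_analyticAt] with t ht
    exact ht.differentiableAt.hasDerivAt
  have hF' : HasDerivAt (deriv f) (deriv (deriv f) 0) 0 := hQ.deriv.differentiableAt.hasDerivAt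
  exact iteratedDeriv_two_units_conj (uLev L u j z) hF hF'

variable [NormOneClass 𝔸]

include hAA' in
/-- **For unitary gauge functions the size of the quadratic term is gauge invariant** (one direction; the other by `u ↦ u⁻¹`): `u` valued in
`U1`, `τ ↦ Q_j(U₀, τA)(c)` analytic at `0` ⟹ `‖∂_τ²|₀ Q_j(U₀^{u}, τA^{u})(c)‖ ≤ ‖∂_τ²|₀ Q_j(U₀, τA)(c)‖`.
[cite: Balaban1985Averaging, (127) p.37, (11) p.19, p.24] -/
theorem norm_iteratedDeriv_two_logCovIter_gaugeAct_le (hu : ∀ x, u x ∈ U1 𝔸) (j : ℕ) (z : Site d) (κ : Fin d)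
    (hQ : AnalyticAt ℂ (fun τ : ℂ => logCovIter L U₀ (τ • A) j z κ) 0) :
    ‖iteratedDeriv 2 (fun τ : ℂ => logCovIter L (gaugeAct u U₀) (τ • A') j z κ) 0‖
      ≤ ‖iteratedDeriv 2 (fun τ : ℂ => logCovIter L U₀ (τ • A) j z κ) 0‖ := by
  rw [iteratedDeriv_two_logCovIter_gaugeAct L u U₀ hAA' j z κ hQ]
  set X := iteratedDeriv 2 (fun τ : ℂ => logCovIter L U₀ (τ • A) j z κ) 0
  set v := uLev L u j z
  have hv : v ∈ U1 𝔸 := hu _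
  -- `‖vXv⁻¹‖ ≤ ‖v‖‖X‖‖v⁻¹‖ ≤ ‖X‖` (the tree's `T4TermwiseBCH.norm_units_conj_le` ∕ `B8CurlGradHolonomy.norm_conj_le`, inlined)
  calc ‖(v : 𝔸) * X * ((v⁻¹ : 𝔸ˣ) : 𝔸)‖ ≤ ‖(v : 𝔸) * X‖ * ‖((v⁻¹ : 𝔸ˣ) : 𝔸)‖ := norm_mul_le _ _
    _ ≤ (‖(v : 𝔸)‖ * ‖X‖) * 1 := mul_le_mul (norm_mul_le _ _) hv.2 (norm_nonneg _) (by positivity)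
    _ ≤ (1 * ‖X‖) * 1 := by gcongr; exact hv.1
    _ = ‖X‖ := by ring

end Composite

end Summit.QuantumFields.BalabanUV.T4Continuum.NE1p.B7AveragingCommutator

end
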